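import Mathlib.LinearAlgebra.BilinearMap
import Mathlib.Algebra.Module.Equiv.Basic
import Mathlib.Algebra.BigOperators.Fin
import Mathlib.LinearAlgebra.Pi
import Mathlib.Tactic.Abel
import Mathlib.Tactic.Ring
import Literature.Topology.FourManifolds.SurfaceGroupGenusOne
import HarnessLib

/-!
# The first homology of the surface group: `H₁(Σ_g; ℤ) = ℤ^{2g}`, its intersection form, and the
# elementary symplectic automorphisms (Zieschang–Vogt–Coldewey §3.6)

Topic `Literature/Topology/FourManifolds`; companion to `GroupTrisections.lean` (the presented
surface group `S_g = ⟨a₁,b₁,…,a_g,b_g ∣ ∏[aᵢ,bᵢ]⟩`) and `SurfaceGroupGenusOne.lean`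
(`SurfaceGroup.toCommGroup`: characters of `S_g`).  DEFINITIONS ONLY (plus their defining
`simp` lemmas); the theorems about them (transitivity of the elementary moves on symplectic
bases = generation of `Sp(2g, ℤ)`, ZVC 3.6.10 / Cor. 3.6.12, and realisation of every move by an
automorphism of `S_g`, ZVC Thm. 3.6.7 (b) / 3.6.9) live in sibling files.

* `symplForm` — the **intersection form** `ν` on `ι × Bool → ℤ` (coordinates `v (i, false)` =
  coefficient of `aᵢ = tᵢ`, `v (i, true)` = coefficient of `bᵢ = uᵢ`):
  `ν(v, w) = ∑ᵢ (v(aᵢ) w(bᵢ) - v(bᵢ) w(aᵢ))` — ZVC 3.6.3 (b) / 3.6.5 (`ν(tⱼ, u_ℓ) = δ_{jℓ}`,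
  `ν(t,t) = ν(u,u) = 0`; "`ν(ω₁, ω₂) = ∑ⱼ (a₁ⱼ b₂ⱼ - b₁ⱼ a₂ⱼ)`").
* `coordMap x y` (`v ↦ v(x) · δ_y`), `shear N c = 1 + c N` (`N² = 0`), and the **elementary
  symplectic automorphisms** of `ι × Bool → ℤ` (ZVC 3.6.9): `moveX i c` (`bᵢ ↦ bᵢ + c aᵢ`) and
  `moveY i c` (`aᵢ ↦ aᵢ + c bᵢ`) — together the type (A) block `SL(2, ℤ)` on handle `i`;
  `moveZ i j c` (`aⱼ ↦ aⱼ + c aᵢ`, `bᵢ ↦ bᵢ - c bⱼ`, the homology action of ZVC's automorphism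
  `α` of type (C)); `moveW i j c` (`bᵢ ↦ bᵢ + c aⱼ`, `bⱼ ↦ bⱼ + c aᵢ`); `permHandles π`
  (type (B), a permutation of the handles).  All are `ℤ`-linear automorphisms (`≃ₗ[ℤ]`).
* `IsSymplecticBasis α β` — `ν(αᵢ, βⱼ) = δᵢⱼ`, `ν(αᵢ, αⱼ) = ν(βᵢ, βⱼ) = 0` (a "canonical basis
  of `H₁`", ZVC 3.6.11; in rank `2|ι|` such a family is automatically a basis, which is proved,
  not assumed, in the sibling file); `isSymplecticBasis_std` for `(δ_{aᵢ}, δ_{bᵢ})`.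
* `SurfaceGroup.abelianize g : S_g →* Multiplicative (surfaceGen g → ℤ)` — the Hurewicz /
  abelianisation map `aᵢ ↦ δ_{aᵢ}`, `bᵢ ↦ δ_{bᵢ}` onto `H₁(Σ_g; ℤ) = ℤ^{2g}` (Hatcher §1.2 p. 51 /
  2A: the abelianisation of `π₁(M_g)` is `ℤ^{2g}`; ZVC 2.7.8), an instance of
  `SurfaceGroup.toCommGroup`.

Design: coordinates `ι × Bool → ℤ` rather than an abstract lattice, so that `H₁` of `S_g` is
literally `surfaceGen g → ℤ` (`surfaceGen g = Fin g × Bool`) and no quotient is taken; the moves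
carry an integer parameter `c` (`shear N c = (shear N 1)^c`, proved in the sibling file) because
Euclid's algorithm uses them with quotients as parameters.  Not here: matrices / Mathlib's
`Matrix.SymplecticGroup` (index type `l ⊕ l`, form `J`); nothing about surfaces as spaces.

## References

* H. Zieschang, E. Vogt, H.-D. Coldewey, *Surfaces and Planar Discontinuous Groups*, LNM 835,
  Springer (1980), §3.6: 3.6.3, 3.6.5 (intersection form), 3.6.7, 3.6.9 (A)–(D), 3.6.10–3.6.12.
  [ZieschangVogtColdewey1980]
* A. Hatcher, *Algebraic Topology*, CUP (2002), §1.2 p. 51. [HatcherAT2002]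
-/

noncomputable section

namespace Literature.Topology.FourManifolds

open Finset

section Form

variable {ι : Type*} [Fintype ι]

/-- The **intersection form** on `H₁(Σ; ℤ) = ℤ^{ι × Bool}` in a canonical basis
(`(i, false) = aᵢ`, `(i, true) = bᵢ`): `ν(v, w) = ∑ᵢ (v(aᵢ) w(bᵢ) - v(bᵢ) w(aᵢ))`, a
`ℤ`-bilinear form (Zieschang–Vogt–Coldewey 3.6.3 (b), 3.6.5).
[cite: ZieschangVogtColdewey1980, 3.6.5] -/
def symplForm : LinearMap.BilinForm ℤ (ι × Bool → ℤ) :=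
  LinearMap.mk₂ ℤ (fun v w => ∑ i, (v (i, false) * w (i, true) - v (i, true) * w (i, false)))
    (fun v v' w => by
      simp only [Pi.add_apply, ← sum_add_distrib]
      exact sum_congr rfl fun i _ => by ring)
    (fun c v w => by
      simp only [Pi.smul_apply, smul_eq_mul, mul_sum]
      exact sum_congr rfl fun i _ => by ring)
    (fun v w w' => by
      simp only [Pi.add_apply, ← sum_add_distrib]
      exact sum_congr rfl fun i _ => by ring)
    (fun c v w => by
      simp only [Pi.smul_apply, smul_eq_mul, mul_sum]
      exact sum_congr rfl fun i _ => by ring)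

/-- Unfolding `symplForm`. [cite: ZieschangVogtColdewey1980, 3.6.5] -/
theorem symplForm_apply (v w : ι × Bool → ℤ) :
    symplForm v w = ∑ i, (v (i, false) * w (i, true) - v (i, true) * w (i, false)) := rfl

/-- Antisymmetry of the intersection form. [cite: ZieschangVogtColdewey1980, 3.6.2 (b)] -/
theorem symplForm_comm (v w : ι × Bool → ℤ) : symplForm v w = -symplForm w v := by
  rw [symplForm_apply, symplForm_apply, ← sum_neg_distrib]
  exact sum_congr rfl fun i _ => by ring

/-- The intersection form is alternating. [cite: ZieschangVogtColdewey1980, 3.6.2 (b)] -/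
theorem symplForm_self (v : ι × Bool → ℤ) : symplForm v v = 0 := by
  rw [symplForm_apply]
  exact sum_eq_zero fun i _ => by ring

end Form

section Moves

variable {ι : Type*} [DecidableEq ι]

/-- The rank-one endomorphism `v ↦ v(x) · δ_y` of `ℤ^{ι × Bool}` (reads coordinate `x` into
coordinate `y`). [folklore] -/
def coordMap (x y : ι × Bool) : (ι × Bool → ℤ) →ₗ[ℤ] (ι × Bool → ℤ) :=
  (LinearMap.single ℤ (fun _ : ι × Bool => ℤ) y).comp (LinearMap.proj x)

/-- `coordMap x y v = v(x) · δ_y`. [folklore] -/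
@[simp] theorem coordMap_apply (x y : ι × Bool) (v : ι × Bool → ℤ) :
    coordMap x y v = Pi.single y (v x) := rfl

/-- The **shear** `1 + c N` along a square-zero endomorphism `N`, a `ℤ`-linear automorphism with
inverse `1 - c N`. [folklore] -/
def shear {V : Type*} [AddCommGroup V] (N : V →ₗ[ℤ] V) (hN : ∀ v, N (N v) = 0)
    (c : ℤ) : V ≃ₗ[ℤ] V where
  toFun v := v + c • N v
  invFun v := v - c • N v
  map_add' v w := by rw [map_add, smul_add]; abel
  map_smul' a v := by rw [LinearMap.map_smul, smul_comm c a, RingHom.id_apply, smul_add]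
  left_inv v := by
    change v + c • N v - c • N (v + c • N v) = v
    rw [map_add, LinearMap.map_smul, hN, smul_zero, add_zero, add_sub_cancel_right]
  right_inv v := by
    change v - c • N v + c • N (v - c • N v) = v
    rw [map_sub, LinearMap.map_smul, hN, smul_zero, sub_zero, sub_add_cancel]

/-- `shear N c v = v + c • N v`. [folklore] -/
@[simp] theorem shear_apply {V : Type*} [AddCommGroup V] (N : V →ₗ[ℤ] V)
    (hN : ∀ v, N (N v) = 0) (c : ℤ) (v : V) : shear N hN c v = v + c • N v := rfl

/-- `(shear N c)⁻¹ v = v - c • N v`. [folklore] -/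
@[simp] theorem shear_symm_apply {V : Type*} [AddCommGroup V] (N : V →ₗ[ℤ] V)
    (hN : ∀ v, N (N v) = 0) (c : ℤ) (v : V) : (shear N hN c).symm v = v - c • N v := rfl

/-- `coordMap x y` is square-zero when `x ≠ y`. [folklore] -/
theorem coordMap_coordMap {x y : ι × Bool} (h : x ≠ y) (v : ι × Bool → ℤ) :
    coordMap x y (coordMap x y v) = 0 := by
  simp [Pi.single_eq_of_ne h]

omit [DecidableEq ι] in
/-- `(i, true) ≠ (i, false)`-type facts used to see that the elementary nilpotents are
square-zero. [folklore] -/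
theorem mk_true_ne_mk_false (i j : ι) : ((i, true) : ι × Bool) ≠ (j, false) := by simp

/-- The nilpotent part of `moveZ`: `v ↦ v(aⱼ) δ_{aᵢ} - v(bᵢ) δ_{bⱼ}`. [folklore] -/
def nilZ (i j : ι) : (ι × Bool → ℤ) →ₗ[ℤ] (ι × Bool → ℤ) :=
  coordMap (j, false) (i, false) - coordMap (i, true) (j, true)

/-- The nilpotent part of `moveW`: `v ↦ v(bᵢ) δ_{aⱼ} + v(bⱼ) δ_{aᵢ}`. [folklore] -/
def nilW (i j : ι) : (ι × Bool → ℤ) →ₗ[ℤ] (ι × Bool → ℤ) :=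
  coordMap (i, true) (j, false) + coordMap (j, true) (i, false)

/-- `nilZ` unfolded. [folklore] -/
@[simp] theorem nilZ_apply (i j : ι) (v : ι × Bool → ℤ) :
    nilZ i j v = Pi.single (i, false) (v (j, false)) - Pi.single (j, true) (v (i, true)) := rfl

/-- `nilW` unfolded. [folklore] -/
@[simp] theorem nilW_apply (i j : ι) (v : ι × Bool → ℤ) :
    nilW i j v = Pi.single (j, false) (v (i, true)) + Pi.single (i, false) (v (j, true)) := rfl

/-- `nilZ i j` is square-zero for `i ≠ j`. [folklore] -/
theorem nilZ_nilZ {i j : ι} (h : i ≠ j) (v : ι × Bool → ℤ) : nilZ i j (nilZ i j v) = 0 := by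
  have h1 : ((j, false) : ι × Bool) ≠ (i, false) := by simpa using h.symm
  have h2 : ((i, true) : ι × Bool) ≠ (j, true) := by simpa using h
  ext x
  simp [Pi.single_eq_of_ne h1, Pi.single_eq_of_ne h2]

/-- `nilW i j` is square-zero. [folklore] -/
theorem nilW_nilW (i j : ι) (v : ι × Bool → ℤ) : nilW i j (nilW i j v) = 0 := by
  ext x
  simp

/-- ZVC 3.6.9 (A): the elementary automorphism `bᵢ ↦ bᵢ + c·aᵢ` of `H₁` (on coordinates:
`v(aᵢ) ↦ v(aᵢ) + c·v(bᵢ)`), the homology action of the automorphism `bᵢ ↦ bᵢ aᵢᶜ` of `S_g`.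
[cite: ZieschangVogtColdewey1980, 3.6.9 (A)] -/
def moveX (i : ι) (c : ℤ) : (ι × Bool → ℤ) ≃ₗ[ℤ] (ι × Bool → ℤ) :=
  shear (coordMap (i, true) (i, false)) (coordMap_coordMap (mk_true_ne_mk_false i i)) c

/-- ZVC 3.6.9 (A): the elementary automorphism `aᵢ ↦ aᵢ + c·bᵢ` of `H₁` (on coordinates:
`v(bᵢ) ↦ v(bᵢ) + c·v(aᵢ)`), the homology action of `aᵢ ↦ aᵢ bᵢᶜ`.
[cite: ZieschangVogtColdewey1980, 3.6.9 (A)] -/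
def moveY (i : ι) (c : ℤ) : (ι × Bool → ℤ) ≃ₗ[ℤ] (ι × Bool → ℤ) :=
  shear (coordMap (i, false) (i, true)) (coordMap_coordMap (mk_true_ne_mk_false i i).symm) c

/-- ZVC 3.6.9 (C): the elementary automorphism `aⱼ ↦ aⱼ + c·aᵢ`, `bᵢ ↦ bᵢ - c·bⱼ` of `H₁`
(`i ≠ j`; on coordinates `v(aᵢ) ↦ v(aᵢ) + c·v(aⱼ)`, `v(bⱼ) ↦ v(bⱼ) - c·v(bᵢ)`), for `c = 1`
the homology action of ZVC's automorphism `α : tⱼ ↦ tⱼtᵢ, uⱼ ↦ tᵢ⁻¹uⱼtᵢ,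
tᵢ ↦ tᵢ⁻¹uⱼtᵢuⱼ⁻¹tᵢ, uᵢ ↦ uᵢtᵢ⁻¹uⱼ⁻¹tᵢ`. [cite: ZieschangVogtColdewey1980, 3.6.9 (C)] -/
def moveZ (i j : ι) (h : i ≠ j) (c : ℤ) : (ι × Bool → ℤ) ≃ₗ[ℤ] (ι × Bool → ℤ) :=
  shear (nilZ i j) (nilZ_nilZ h) c

/-- The elementary automorphism `bᵢ ↦ bᵢ + c·aⱼ`, `bⱼ ↦ bⱼ + c·aᵢ` of `H₁` (on coordinates
`v(aⱼ) ↦ v(aⱼ) + c·v(bᵢ)`, `v(aᵢ) ↦ v(aᵢ) + c·v(bⱼ)`), the symmetric shear `(1 S; 0 1)` with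
`S = c(Eᵢⱼ + Eⱼᵢ)`; a product of moves of types (A) and (C) (sibling file). [folklore] -/
def moveW (i j : ι) (c : ℤ) : (ι × Bool → ℤ) ≃ₗ[ℤ] (ι × Bool → ℤ) :=
  shear (nilW i j) (nilW_nilW i j) c

/-- ZVC 3.6.9 (B): a permutation `π` of the handles acting on `H₁` (`δ_{(i,ε)} ↦ δ_{(π i, ε)}`;
on coordinates `(π·v)(j, ε) = v(π⁻¹ j, ε)`). [cite: ZieschangVogtColdewey1980, 3.6.9 (B)] -/
def permHandles (π : Equiv.Perm ι) : (ι × Bool → ℤ) ≃ₗ[ℤ] (ι × Bool → ℤ) :=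
  LinearEquiv.funCongrLeft ℤ ℤ (Equiv.prodCongr π.symm (Equiv.refl Bool))

/-- `moveX` on coordinates. [folklore] -/
theorem moveX_apply (i : ι) (c : ℤ) (v : ι × Bool → ℤ) :
    moveX i c v = v + c • Pi.single (i, false) (v (i, true)) := rfl

/-- `moveY` on coordinates. [folklore] -/
theorem moveY_apply (i : ι) (c : ℤ) (v : ι × Bool → ℤ) :
    moveY i c v = v + c • Pi.single (i, true) (v (i, false)) := rfl

/-- `moveZ` on coordinates. [folklore] -/
theorem moveZ_apply (i j : ι) (h : i ≠ j) (c : ℤ) (v : ι × Bool → ℤ) :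
    moveZ i j h c v =
      v + c • (Pi.single (i, false) (v (j, false)) - Pi.single (j, true) (v (i, true))) := rfl

/-- `moveW` on coordinates. [folklore] -/
theorem moveW_apply (i j : ι) (c : ℤ) (v : ι × Bool → ℤ) :
    moveW i j c v =
      v + c • (Pi.single (j, false) (v (i, true)) + Pi.single (i, false) (v (j, true))) := rfl

omit [DecidableEq ι] in
/-- `permHandles` on coordinates. [folklore] -/
@[simp] theorem permHandles_apply (π : Equiv.Perm ι) (v : ι × Bool → ℤ) (x : ι × Bool) :
    permHandles π v x = v (π.symm x.1, x.2) := rfl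

/-- `permHandles` on basis vectors: `δ_{(i,ε)} ↦ δ_{(π i, ε)}`. [folklore] -/
@[simp] theorem permHandles_single (π : Equiv.Perm ι) (x : ι × Bool) (n : ℤ) :
    permHandles π (Pi.single x n) = Pi.single (π x.1, x.2) n := by
  ext y
  rw [permHandles_apply]
  obtain ⟨i, ε⟩ := x
  obtain ⟨j, ε'⟩ := y
  by_cases h : ((π.symm j, ε') : ι × Bool) = (i, ε)
  · simp only [Prod.mk.injEq] at h
    obtain ⟨rfl, rfl⟩ := h
    simp
  · rw [Pi.single_eq_of_ne h, Pi.single_eq_of_ne]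
    contrapose! h
    simp only [Prod.mk.injEq] at h ⊢
    exact ⟨by rw [h.1, Equiv.symm_apply_apply], h.2⟩

end Moves

section Basis

variable {ι : Type*} [Fintype ι] [DecidableEq ι]

/-- `ν(m·δ_{aᵢ}, w) = m · w(bᵢ)`: pairing with `aᵢ` reads off the `bᵢ`-coordinate.
[cite: ZieschangVogtColdewey1980, 3.6.3 (b)] -/
@[simp] theorem symplForm_single_false_left (i : ι) (m : ℤ) (w : ι × Bool → ℤ) :
    symplForm (Pi.single (i, false) m : ι × Bool → ℤ) w = m * w (i, true) := by
  rw [symplForm_apply, sum_eq_single i (fun k _ hk => by simp [hk]) (by simp)]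
  simp

/-- `ν(m·δ_{bᵢ}, w) = -m · w(aᵢ)`. [cite: ZieschangVogtColdewey1980, 3.6.3 (b)] -/
@[simp] theorem symplForm_single_true_left (i : ι) (m : ℤ) (w : ι × Bool → ℤ) :
    symplForm (Pi.single (i, true) m : ι × Bool → ℤ) w = -(m * w (i, false)) := by
  rw [symplForm_apply, sum_eq_single i (fun k _ hk => by simp [hk]) (by simp)]
  simp

/-- `ν(v, n·δ_{bⱼ}) = v(aⱼ) · n`. [cite: ZieschangVogtColdewey1980, 3.6.3 (b)] -/
@[simp] theorem symplForm_single_true_right (v : ι × Bool → ℤ) (j : ι) (n : ℤ) :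
    symplForm v (Pi.single (j, true) n : ι × Bool → ℤ) = v (j, false) * n := by
  rw [symplForm_apply, sum_eq_single j (fun k _ hk => by simp [hk]) (by simp)]
  simp

/-- `ν(v, n·δ_{aⱼ}) = -v(bⱼ) · n`. [cite: ZieschangVogtColdewey1980, 3.6.3 (b)] -/
@[simp] theorem symplForm_single_false_right (v : ι × Bool → ℤ) (j : ι) (n : ℤ) :
    symplForm v (Pi.single (j, false) n : ι × Bool → ℤ) = -(v (j, true) * n) := by
  rw [symplForm_apply, sum_eq_single j (fun k _ hk => by simp [hk]) (by simp)]
  simp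

/-- A **symplectic basis** (canonical basis of `H₁`, ZVC 3.6.11) of `ℤ^{ι × Bool}`: families
`α β : ι → ℤ^{ι × Bool}` with `ν(αᵢ, βⱼ) = δᵢⱼ` and `ν(αᵢ, αⱼ) = ν(βᵢ, βⱼ) = 0`.  (That such a
family spans is a theorem of the sibling file, not part of the definition.)
[cite: ZieschangVogtColdewey1980, 3.6.11] -/
def IsSymplecticBasis (α β : ι → ι × Bool → ℤ) : Prop :=
  (∀ i j, symplForm (α i) (β j) = if i = j then 1 else 0) ∧
    (∀ i j, symplForm (α i) (α j) = 0) ∧ ∀ i j, symplForm (β i) (β j) = 0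

/-- The coordinate basis `(δ_{aᵢ})ᵢ, (δ_{bᵢ})ᵢ` is a symplectic basis
(`ν(tⱼ, u_ℓ) = δ_{jℓ}`, `ν(t, t) = ν(u, u) = 0`). [cite: ZieschangVogtColdewey1980, 3.6.3 (b)] -/
theorem isSymplecticBasis_std :
    IsSymplecticBasis (fun i : ι => (Pi.single (i, false) 1 : ι × Bool → ℤ))
      (fun i => Pi.single (i, true) 1) := by
  refine ⟨fun i j => ?_, fun i j => ?_, fun i j => ?_⟩
  · rw [symplForm_single_false_left, one_mul]
    change (Pi.single (j, true) 1 : ι × Bool → ℤ) (i, true) = _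
    rw [Pi.single_apply]
    simp
  · simp
  · simp

end Basis


/-! ### The abelianisation of the surface group -/

/-- The **abelianisation / Hurewicz map** of the surface group onto `H₁(Σ_g; ℤ) = ℤ^{2g}`,
`aᵢ ↦ δ_{aᵢ}`, `bᵢ ↦ δ_{bᵢ}` (exponent sums in the generators; well defined because the relator
`∏[aᵢ, bᵢ]` dies in every abelian group, `SurfaceGroup.toCommGroup`).  Hatcher §1.2 p. 51:
"the abelianization of `π₁(M_g)` is … the product of `2g` copies of `ℤ`".
[cite: HatcherAT2002, §1.2 p. 51] -/
def SurfaceGroup.abelianize (g : ℕ) : SurfaceGroup g →* Multiplicative (surfaceGen g → ℤ) :=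
  SurfaceGroup.toCommGroup fun x => Multiplicative.ofAdd (Pi.single x 1)

/-- `abelianize` on a generator. [folklore] -/
@[simp] theorem SurfaceGroup.abelianize_of {g : ℕ} (x : surfaceGen g) :
    SurfaceGroup.abelianize g (PresentedGroup.of x) = Multiplicative.ofAdd (Pi.single x 1) :=
  SurfaceGroup.toCommGroup_of _ x

/-- `abelianize` on the class of a word is the exponent-sum vector of the word. [folklore] -/
theorem SurfaceGroup.abelianize_mk {g : ℕ} (w : FreeGroup (surfaceGen g)) :
    SurfaceGroup.abelianize g (PresentedGroup.mk _ w) =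
      FreeGroup.lift (fun x => Multiplicative.ofAdd (Pi.single x (1 : ℤ))) w := rfl

end Literature.Topology.FourManifolds

end
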